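import Summits.HodgeConjecture.HodgeConjecture.Theses.NikulinTwinTransport
import Literature.AlgebraicGeometry.HodgeTheory.ChernCharacterBetti
import Literature.AlgebraicGeometry.HodgeTheory.HardLefschetzComplexification
import Literature.AlgebraicGeometry.Surfaces.K3Surface

/-!
# `NikulinSerreCarrierAlg` — the ALGEBRAIC NORMAL FORM of the informal crux `NikulinSerreCarrier`
(stmt-HodgeConjecture-14464, route NikulinTwinTransport), typed over existing declarations

Crux work-file written by the crux-plan planner of line `neron-severi-intertwiner`
(planner-cruxplan-stmt-HodgeConjecture-14464-neron-severi-intertw-0, 2026-08-16). Companion — not rival — of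
`TypedCrux.lean` (planner of line modular-twin-address: the ANALYTIC transcription K1∃ with a hyperholomorphic
connection in the conclusion). Both exist because the route item is INFORMAL (`signature: null`, no
`def NikulinSerreCarrier` in the route file), so no line can be audited against the route decl; each line is
audited against a typed decl in this directory with
`ledger skeleton check <Lines/x.lean> --crux <item> --crux-decl Summit.HodgeConjecture.HodgeConjecture.Cruxes.NikulinSerreCarrier.<Decl>`,
and the route planner is asked (evidence SIGNATURE-PROPOSAL.md on the item; definition items
`defn-IsKaehlerClass`, `defn-IsMuStableBetti`) to install one of them — or their conjunction — by `route edit`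
(the imports above are outside the route file's present import closure; set-signature cannot add them).

## What is typed here (the triage panel's "cheapest typable signature", r1-1 §3 / r1-2 §4 / r1-3 §2)
`NikulinSerreCarrierAlg`: for every orientation family `μ` with Poincaré duality and every Chern character
`C : ChernCharacterBetti` that is COHERENT-ADDITIVE on smooth projective varieties and SIGN-NORMALISED, there are
projective K3 surfaces `X, Y`, integral generators `p, p′` of `H⁴`, a rational type-preserving 2-similitude
`Ψ : H²(Y) → H²(X)` (the route's own hypothesis block), a RATIONAL class `H′` with `H′`, `Ψ H′` and
`Ω := fst^*Ψ H′ + snd^*H′` KÄHLER (`IsKaehlerClass`: class of the Kähler form of a Kähler metric on a Hodge model;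
rational + Kähler = ℚ-ample), a positively oriented volume generator (`Ω⁴ = q·vol`, `q > 0`), and a VECTOR
BUNDLE `G` of rank `r` on `W = X ⊗ Y`, `μ_Ω`-STABLE (Huybrechts–Lehn Def. 1.2.12, strict; degrees
`ch₁(F) ∪ Ω³ = d·vol` of coherent subsheaves), with `fst_*(snd^* y ∪ κ_G) = m·Ψ y` for all `y ∈ H²(Y)`,
`m ≠ 0`, where `κ_G = ch₁(G)² − 2r·ch₂(G) = c₂(End G)` (the Néron–Severi INTERTWINER class).

## Relation to the informal text and to `TypedCrux.lean`
* informal K1 ⟸ this: `End G` is `Ω`-polystable with `c₁ = 0` and `c₂(End G) = κ_G`, whose mixed component is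
  `m·graph Ψ`; `Ω` is a Ψ-matched Kähler pair (`ω′ = H′`, `ω = Ψ ω′`); by Donaldson–Uhlenbeck–Yau + Verbitsky
  Thm 2.5 the Chern connection of `End G` is hyperholomorphic for the matched product hyperkähler metric, and
  openness of stability in the Kähler class reaches the generic matched directions K2 needs — this is the
  TRANSFER stub of the line, kept informal until K2 is typed; `TypedCrux.NikulinSerreCarrier` puts that
  analytic conclusion INTO the statement instead.
* EXISTENTIAL over the anchor and the frame (the route needs one of each); `κ_G = m·Ψ` with `κ_G` algebraic forces
  `graph Ψ` algebraic at the chosen anchor, so the Nikulin pair stays the only known source (the line's stub S1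
  exhibits it); `TypedCrux.lean` instead quantifies the Nikulin data universally as hypotheses.
* SCALARS. `m ∈ ℂ ∖ 0`, deliberately NOT `m ∈ ℤ`: (i) `complexGysin μ` rescales by a non-zero complex constant
  with the orientation family (`complexGysin_eq_smul_of_orientationFamily`); (ii) `ChernCharacterBetti` is pinned
  only up to `chᵢ ↦ λⁱ chᵢ`, `λ ∈ ℚ^×` (no `c₁(𝒪(D)) = [D]` normalisation), so an integrality clause on `m`
  quantified over ALL instances `C` cannot be met by ONE carrier (`λ²m ∈ ℤ` for every `λ`); it can only be met
  by letting the carrier depend on the instance (direct sums `G^{⊕k}` rescale `m` by `k`) — harmless for a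
  POLYSTABLE conclusion (cross-check note for `TypedCrux.lean`, whose conclusion asks `m : ℤ` under `∀ C`), fatal
  for the STABLE one typed here. The true `m` is an even positive integer (Disproof §A/§C/§H) — a theorem about
  the true instance.
* SIGN. The instance `((-1)^i chᵢ)` satisfies every field of `ChernCharacterBetti` and swaps stable with
  anti-stable; `SignNormalised C` (effective line bundles have non-negative degree against Kähler classes)
  excludes it, and `CoherentAdditive` is needed because the structure's intended instance is `0` off bundles.
  Frame positivity is UNCONDITIONAL (`IsKaehlerClass` is a genuine predicate: multiplicativity of the de Rham
  family allows positive rescalings only), so the sign hypotheses cannot be exploited by an anti-ample frame.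
* No vacuity: `G = 0` or a line bundle give `κ_G = 0 ≠ m·Ψ`; `Ψ = 0` is excluded by the similitude clause; an
  orientation-reversing "(−2)-similitude" cannot exist (signature `(3,19)`).
* Locus-leaving (Lemma L / `Theorems/NikulinSerreCarrier/Negative/InvariantCarrierPinned`): `im κ_G = im Ψ =
  H²(X) ⊄ E₈(−2)^⊥` — built in.
-/

noncomputable section

open CategoryTheory CategoryTheory.Limits AlgebraicGeometry
open scoped Manifold ContDiff
open Literature.AlgebraicGeometry
open Literature.AlgebraicGeometry.HodgeTheory
open Literature.AlgebraicTopology.SingularHomology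
open Literature.Geometry.Kaehler

set_option linter.dupNamespace false
set_option linter.unusedVariables false

namespace Summit.HodgeConjecture.HodgeConjecture.Cruxes.NikulinSerreCarrier

namespace Alg

/-! ## Vocabulary of the algebraic normal form (all on the real carrier `H^*(–(ℂ); ℂ)`) -/

/-- Degree bookkeeping: `2·1 + 2·3 = 2·4`. -/
theorem deg_1_3 : 2 * 1 + 2 * 3 = 2 * 4 := by norm_num

/-- Degree bookkeeping: `2·1 + 2·2 = 2·1 + 2·2` (cup `snd^* y ∪ γ` lands in `H⁶`). -/
theorem deg_1_2 : 2 * 1 + 2 * 2 = 2 * 1 + 2 * 2 := rfl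

/-- **Kähler class** on the summit carrier: `H ∈ H²(S(ℂ); ℂ)` is the class of the Kähler form of a
smooth Kähler metric `g` on some Hodge model `A` of `S` (its analytification), read through a natural
multiplicative real de Rham comparison family `e` and the comparison `A.pullback` — verbatim the idiom of
`HodgeModel.existsUnique_pullback_eq_kaehlerClass`. A RATIONAL Kähler class on a projective variety is a
`ℚ`-ample class (Kodaira); this is how "ample" is said below, and it is what the informal K1 → K2 interface
needs (product hyperkähler metrics exist exactly in Kähler classes). -/
def IsKaehlerClass (n : ℕ) (S : Motives.SchemeOver ℂ) (H : complexBetti S 2) : Prop :=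
  ∃ (A : HodgeModel n S)
    (hω : isSmoothForm_kaehlerForm_of_isManifold_complex (E := A.model) (M := A.carrier))
    (g : Bundle.ContMDiffRiemannianMetric 𝓘(ℝ, A.model) ∞ A.model
      (fun x : A.carrier ↦ TangentSpace 𝓘(ℝ, A.model) x))
    (hg : g.toRiemannianMetric.IsKaehler)
    (e : Literature.NumberTheory.Transcendental.DeRhamIsoFamily 𝓘(ℝ, A.model)),
    e.IsNatural ∧ e.IsMultiplicative ∧
      A.pullback 2 H = ofRealClass A.carrier 2 (e A.carrier 2 (g.kaehlerClass hω hg))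

/-- **Coherent additivity** of a Chern character `C` on `W`: `ch(F) = ch(F′) + ch(F″)` for every short
exact sequence of finitely presented `𝒪_W`-modules (Fulton §15.1: on a smooth quasi-projective variety `ch`
extends additively from vector bundles to coherent sheaves through finite locally free resolutions).
`ChernCharacterBetti.ch_shortExact` asserts this for bundles only (its intended instance is `0` off
bundles), so the normal form quantifies over ALL instances `C` and asks this — on smooth projective
varieties, where resolution-extended instances exist — as the hypothesis pinning `ch` on the torsion-free,
non-locally-free subsheaves that slope stability tests. -/
def CoherentAdditive (C : ChernCharacterBetti) (W : Motives.SchemeOver ℂ) : Prop :=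
  ∀ (S : ShortComplex W.left.Modules), S.ShortExact →
    SheafOfModules.IsFinitePresentation S.X₁ → SheafOfModules.IsFinitePresentation S.X₂ →
      SheafOfModules.IsFinitePresentation S.X₃ →
        ∀ i : ℕ, C.ch W S.X₂ i = C.ch W S.X₁ i + C.ch W S.X₃ i

/-- `F` has (generic) rank `s` as read by `C`: `ch₀(F) = s · 1` (for a vector bundle on the connected `W`
its rank, `ChernCharacterBetti.ch_free_zero`; for coherent `F` the alternating sum of the ranks of a
locally free resolution = the generic rank, granted `CoherentAdditive C W`). -/
def HasChRank (C : ChernCharacterBetti) (W : Motives.SchemeOver ℂ) (F : W.left.Modules) (s : ℕ) :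
    Prop :=
  C.ch W F 0 = (s : ℂ) • singularCohomology.one ℂ (Motives.ComplexPoints W)

/-- `deg_Ω(F) = d` on a fourfold `W`: `ch₁(F) ∪ Ω³ = d · vol` for the chosen volume generator
`vol ∈ H⁸(W(ℂ); ℂ)` (Huybrechts–Lehn Def. 1.2.11, `deg_H E = c₁(E)·H^{n−1}`, `c₁ = ch₁`). -/
def HasDegree (C : ChernCharacterBetti) (W : Motives.SchemeOver ℂ) (Ω : complexBetti W (2 * 1))
    (vol : complexBetti W (2 * 4)) (F : W.left.Modules) (d : ℚ) : Prop :=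
  cupProduct deg_1_3 (C.ch W F 1) (cupPowTwo Ω 3) = (d : ℂ) • vol

/-- The volume generator is POSITIVELY oriented by the frame: `Ω⁴ = q · vol`, `q > 0` (the sign of every
degree is then that of an intersection number with the positive class `Ω`, independent of orientation
conventions and of the orientation family `μ`). -/
def PositivelyOriented (W : Motives.SchemeOver ℂ) (Ω : complexBetti W (2 * 1))
    (vol : complexBetti W (2 * 4)) : Prop :=
  ∃ q : ℚ, 0 < q ∧ cupPowTwo Ω 4 = (q : ℂ) • vol

/-- Effective line bundles have non-negative `Ω`-degree: for every `𝒪_W`-module `L` of rank `≤ 1` receiving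
a monomorphism from `𝒪_W`, `deg_Ω(L) ≥ 0`. -/
def EffectiveNonneg (C : ChernCharacterBetti) (W : Motives.SchemeOver ℂ) (Ω : complexBetti W (2 * 1))
    (vol : complexBetti W (2 * 4)) : Prop :=
  ∀ (L : W.left.Modules), Motives.HasRankLE L 1 →
    (∃ s : SheafOfModules.free (R := W.left.ringCatSheaf) PUnit ⟶ L, Mono s) →
      ∃ d : ℚ, 0 ≤ d ∧ HasDegree C W Ω vol L d

/-- **Sign normalisation of the instance `C`** (a property of the Chern character, FALSE for the
sign-flipped instance `((-1)^i chᵢ)`, which satisfies every field of `ChernCharacterBetti`): on every smooth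
projective fourfold, for every Kähler class `Ω` and positively oriented volume generator, effective line
bundles have non-negative `Ω`-degree (`∫_D Ω³ ≥ 0`). Quantifying over all `C` with THIS hypothesis makes
"`μ_Ω`-stable" mean stable rather than anti-stable; the remaining ambiguity among instances is a positive
rational rescaling `chᵢ ↦ λⁱ chᵢ`, under which everything below is invariant. -/
def SignNormalised (C : ChernCharacterBetti) : Prop :=
  ∀ (W : Motives.SchemeOver ℂ) (Ω : complexBetti W (2 * 1)) (vol : complexBetti W (2 * 4)),
    Motives.IsSmoothProjective 4 W → IsKaehlerClass 4 W Ω → PositivelyOriented W Ω vol →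
      EffectiveNonneg C W Ω vol

/-- **Slope (Mumford–Takemoto) STABILITY** of an `𝒪_W`-module `G` of rank `r` on the fourfold `W` with
respect to `Ω` (Huybrechts–Lehn Def. 1.2.12, strict form): `deg_Ω G = d_G ∈ ℚ` and every coherent subsheaf
`F ↪ G` of rank `s`, `0 < s < r`, has `deg_Ω F = d_F` with `d_F · r < d_G · s` (`μ(F) < μ(G)`). Companion of
the tree's `Motives.IsSlopeSemistable` (abstract Weil cohomology, `≤`), here on the real carrier. -/
def IsMuStable (C : ChernCharacterBetti) (W : Motives.SchemeOver ℂ) (Ω : complexBetti W (2 * 1))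
    (vol : complexBetti W (2 * 4)) (G : W.left.Modules) (r : ℕ) : Prop :=
  ∃ dG : ℚ, HasDegree C W Ω vol G dG ∧
    ∀ (F : W.left.Modules) (f : F ⟶ G), Mono f → SheafOfModules.IsFinitePresentation F →
      ∀ s : ℕ, 0 < s → s < r → HasChRank C W F s →
        ∃ dF : ℚ, HasDegree C W Ω vol F dF ∧ dF * r < dG * s

/-- **The Néron–Severi intertwiner class** `κ_G := c₂(End G) = ch₁(G)² − 2r·ch₂(G) ∈ H⁴(W(ℂ); ℂ)` of a
rank-`r` sheaf (`ch(End G) = ch(G)·ch(G^∨)` gives `ch₂(End G) = 2r·ch₂ − ch₁²`, and `c₂ = −ch₂` as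
`c₁(End G) = 0`); twist-invariant; its `(2,2)`-Künneth component is the card's `κ`. -/
def kappaClass (C : ChernCharacterBetti) (W : Motives.SchemeOver ℂ) (G : W.left.Modules) (r : ℕ) :
    complexBetti W (2 * 2) :=
  cupProduct (rfl : 2 * 1 + 2 * 1 = 2 * 2) (C.ch W G 1) (C.ch W G 1) - (2 * (r : ℂ)) • C.ch W G 2

/-- The ACTION `[γ]_* : H²(Y(ℂ)) → H²(X(ℂ))`, `y ↦ fst_*(snd^* y ∪ γ)`, of a class `γ ∈ H⁴((X ⊗ Y)(ℂ))` on a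
product of smooth projective surfaces, as a linear map — the shape used verbatim by the route's items
(`TwinSimilitudeAlgebraic`, `HodgeIsometryAlgebraic`). Only the `(2,2)`-Künneth component of `γ` acts. -/
def corrAction (μ : OrientationFamily) {X Y : Motives.SchemeOver ℂ} (hX : Motives.IsSmoothProjective 2 X)
    (hY : Motives.IsSmoothProjective 2 Y) (γ : complexBetti (MonoidalCategoryStruct.tensorObj X Y) (2 * 2)) :
    complexBetti Y (2 * 1) →ₗ[ℂ] complexBetti X (2 * 1) :=
  complexGysin μ (Motives.IsSmoothProjective.tensor_holds hX hY) hX (SemiCartesianMonoidalCategory.fst X Y)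
      (rfl : 2 * 1 + 2 * 2 + 2 * 2 = 2 * 1 + 2 * (2 + 2)) ∘ₗ
    (cupProduct deg_1_2).flip γ ∘ₗ
      (complexBetti.map (SemiCartesianMonoidalCategory.snd X Y) (2 * 1)).hom

/-- Unfolding `corrAction`: `[γ]_* y = fst_*(snd^* y ∪ γ)`. -/
theorem corrAction_apply (μ : OrientationFamily) {X Y : Motives.SchemeOver ℂ}
    (hX : Motives.IsSmoothProjective 2 X) (hY : Motives.IsSmoothProjective 2 Y)
    (γ : complexBetti (MonoidalCategoryStruct.tensorObj X Y) (2 * 2)) (y : complexBetti Y (2 * 1)) :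
    corrAction μ hX hY γ y =
      complexGysin μ (Motives.IsSmoothProjective.tensor_holds hX hY) hX
        (SemiCartesianMonoidalCategory.fst X Y) (rfl : 2 * 1 + 2 * 2 + 2 * 2 = 2 * 1 + 2 * (2 + 2))
        (cupProduct deg_1_2 (complexBetti.map (SemiCartesianMonoidalCategory.snd X Y) (2 * 1) y) γ) :=
  rfl

/-- `p` generates the integral classes of `H⁴` of a surface (verbatim the route's clause). -/
def IsTopGenerator {S : Motives.SchemeOver ℂ} (p : complexBetti S (2 * 2)) : Prop :=
  IsIntegralClass p ∧ ∀ q : complexBetti S (2 * 2), IsIntegralClass q → ∃ n : ℤ, q = n • p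

/-- `Ψ : H²(Y(ℂ)) → H²(X(ℂ))` is a RATIONAL, TYPE-PRESERVING **2-similitude** for the generators `p, p'`:
`(x.y) = a p' ⟹ (Ψx.Ψy) = 2a p` (verbatim the hypothesis block of `TwinSimilitudeAlgebraic`). -/
def IsRationalHodgeTwoSimilitude {X Y : Motives.SchemeOver ℂ} (p : complexBetti X (2 * 2))
    (p' : complexBetti Y (2 * 2)) (Ψ : complexBetti Y (2 * 1) →ₗ[ℂ] complexBetti X (2 * 1)) : Prop :=
  (∀ x, IsRationalClass x → IsRationalClass (Ψ x)) ∧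
  (∀ (i j : ℕ) x, IsOfHodgeType 2 Y (2 * 1) i j x → IsOfHodgeType 2 X (2 * 1) i j (Ψ x)) ∧
  (∀ (x y : complexBetti Y (2 * 1)) (a : ℂ),
    cupProduct (rfl : 2 * 1 + 2 * 1 = 2 * 2) x y = a • p' →
      cupProduct (rfl : 2 * 1 + 2 * 1 = 2 * 2) (Ψ x) (Ψ y) = ((2 : ℂ) * a) • p)

/-- The Ψ-MATCHED product class `Ω(H′) := fst^*(Ψ H′) + snd^* H′ ∈ H²((X ⊗ Y)(ℂ))`. -/
def matchedClass {X Y : Motives.SchemeOver ℂ} (Ψ : complexBetti Y (2 * 1) →ₗ[ℂ] complexBetti X (2 * 1))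
    (H' : complexBetti Y (2 * 1)) : complexBetti (MonoidalCategoryStruct.tensorObj X Y) (2 * 1) :=
  complexBetti.map (SemiCartesianMonoidalCategory.fst X Y) (2 * 1) (Ψ H') +
    complexBetti.map (SemiCartesianMonoidalCategory.snd X Y) (2 * 1) H'

/-- `NS(Y)_ℂ^⊥`-membership: `t` is orthogonal to every class supported on a divisor (`t ∈ T(Y)_ℂ`). -/
def IsTranscendental {Y : Motives.SchemeOver ℂ} (t : complexBetti Y (2 * 1)) : Prop :=
  ∀ d ∈ algebraicClasses Y 1, cupProduct (rfl : 2 * 1 + 2 * 1 = 2 * 2) t d = 0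

end Alg

open Alg

/-! ## The typed crux decl (algebraic normal form) -/

/-- **`NikulinSerreCarrierAlg` — algebraic normal form of the informal crux `NikulinSerreCarrier`
(neron-severi-intertwiner, triage-sharpened; PROPOSED signature, see module docstring).** For every orientation family with Poincaré duality and every Chern character `C` that
is coherent-additive on smooth projective varieties and sign-normalised, there are projective K3 surfaces
`X, Y` (the anchor), integral generators `p, p'` of `H⁴`, a rational type-preserving 2-similitude
`Ψ : H²(Y) → H²(X)`, a RATIONAL class `H′` on `Y` with `H′`, `Ψ H′` and the matched product class
`Ω = Ψ H′ ⊞ H′` Kähler (the rational Ψ-matched ample frame), a positively oriented volume generator of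
`W = X ⊗ Y`, and a VECTOR BUNDLE `G` of rank `r` on `W`, `μ_Ω`-STABLE, whose intertwiner class acts on
`H²(Y)` EXACTLY as a non-zero multiple of `Ψ`: `[κ_G]_* = m·Ψ`, `m ≠ 0` (`m ∈ ℂ`: the TRUE `m` is an even
positive integer, Disproof §A/§C/§H — invisible on this carrier, where `μ` and `C` are pinned only up to
non-zero scalars). Informal K1 follows (line card, Transfer): `End G` is `Ω`-polystable with `c₁ = 0` and
`c₂(End G) = κ_G`; `Ω` is a Ψ-matched Kähler pair; openness of stability reaches the generic matched
directions. -/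
def NikulinSerreCarrierAlg : Prop :=
  ∀ (μ : OrientationFamily), μ.HasPoincareDuality → ∀ (C : ChernCharacterBetti),
    (∀ (n : ℕ) (W : Motives.SchemeOver ℂ), Motives.IsSmoothProjective n W → CoherentAdditive C W) →
    SignNormalised C →
    ∃ (X Y : Motives.SchemeOver ℂ) (hX : Surfaces.IsK3Surface X) (hY : Surfaces.IsK3Surface Y)
      (p : complexBetti X (2 * 2)) (p' : complexBetti Y (2 * 2))
      (Ψ : complexBetti Y (2 * 1) →ₗ[ℂ] complexBetti X (2 * 1)) (H' : complexBetti Y (2 * 1))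
      (vol : complexBetti (MonoidalCategoryStruct.tensorObj X Y) (2 * 4))
      (r : ℕ) (G : (MonoidalCategoryStruct.tensorObj X Y).left.Modules) (m : ℂ),
      IsTopGenerator p ∧ IsTopGenerator p' ∧ IsRationalHodgeTwoSimilitude p p' Ψ ∧
      IsRationalClass H' ∧ IsKaehlerClass 2 Y H' ∧ IsKaehlerClass 2 X (Ψ H') ∧
      IsKaehlerClass 4 (MonoidalCategoryStruct.tensorObj X Y) (matchedClass Ψ H') ∧
      PositivelyOriented (MonoidalCategoryStruct.tensorObj X Y) (matchedClass Ψ H') vol ∧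
      Motives.IsVectorBundle G ∧ HasChRank C _ G r ∧
      IsMuStable C _ (matchedClass Ψ H') vol G r ∧ m ≠ 0 ∧
      ∀ y : complexBetti Y (2 * 1), corrAction μ hX.1 hY.1 (kappaClass C _ G r) y = m • Ψ y


end Summit.HodgeConjecture.HodgeConjecture.Cruxes.NikulinSerreCarrier

end
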